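import Summits.QuantumFields.BalabanUV.T4Continuum.Support.NE7DefectIterationCompact
import Summits.QuantumFields.BalabanUV.T4Continuum.Support.MinimalActionCompact
import Summits.QuantumFields.BalabanUV.T4Continuum.Support.NE3EnergyShapes
import HarnessLib

/-!
# NE7GaugeGroupCompact — THE PERIODIC UNITARY SITE-GAUGE GROUP IS COMPACT, AND THE (S1) ENGINE RUNS ON IT (memo ROAD-G100 §2.5 ∕ §3 (v)): Tychonoff over the sites ×
# compactness of `U(n)` in the units topology (`MinimalActionCompact.isCompact_unitaryUnits`), closedness of periodicity; first countability of the ambient product (the units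
# embed in `M × Mᵐᵒᵖ`); hence `NE7DefectIterationCompact.exists_zero_defect_local_of_compact` with `K` = the unitary `P`-periodic site gauges

Cell `pub-balaban`, rung (B)+1 sub-cell t4, lineage `b2b-balaban-t4-ne7-p1`, generation 100 (CRUX PROVER NE7 #1 = OWNER of BINDER row NE7).  Memo `t4/b2b-balaban-t4-ne7-p1-g100/ROAD-G100.md`
§2.5: the state of the (S1) iteration is a unitary `(N·M)`-periodic site gauge `u : Site d → (Matrix n n ℂ)ˣ` (the shape `IsUnitarySite u ∧ IsPeriodicSite u P` of the ENDs' `hdecomp`), and the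
existence of the EXACT slice representative is the engine `NE7DefectIterationCompact.exists_zero_defect_local` run on the set of such gauges.  THIS FILE supplies the topology once:
§1 `continuous_site_eval`; **`isCompact_unitaryPeriodicSite`** (`{u | IsUnitarySite u ∧ IsPeriodicSite u P}` is compact in the product of the units topologies); `isClosed_isPeriodicSite`;
§2 **`exists_zero_defect_gauge`** (first countability of the ambient space `Site d → (Matrix n n ℂ)ˣ` inline: countably many factors, each embedded in the metrisable `M × Mᵐᵒᵖ`): the engine with `K` = unitary `P`-periodic site gauges — for a size functional `Φ` (values in any seminormed group; continuous on `K`) and a defect `Df`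
   (continuous and `≥ 0` on the working region `{‖Φ‖ ≤ S}`), a step that preserves unitarity∕periodicity, contracts `Df` by `θ < 1` and moves `‖Φ‖` by `≤ A·Df` there, and a datum `u₀`:
   `∃ u`, unitary, `P`-periodic, `Df u = 0`, `‖Φ u‖ ≤ s₀ + A·δ₀∕(1 − θ)`.
HONEST FRAMING (page 1): topology∕bookkeeping only; the letters of the step (memo §2.3) and the curved sup letter (memo §4) are NOT here; NOT (S1), NOT NE7; spine 0∕9; finite T⁴ rung (B)+1 —
NOT infinite volume, NOT mass gap, NOT BetaPertH, NOT Clay.  Continuum YM on T⁴ ⇐ BetaPertH ∧ nine spine estimates (0/9 proved); BetaPertH ⇐ (D1) ∧ (D4) ∧ CAP+tail; G-an2-4 gates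
asym, D1 and NE2/3/4.
-/

set_option autoImplicit false

open scoped Matrix.Norms.L2Operator
open Topology

namespace Summit.QuantumFields.BalabanUV.T4Continuum.NE7GaugeGroupCompact

open Literature.MathematicalPhysics.QuantumFieldTheory.Balaban1983to89
open B7Prop1Explicit B7Prop2Explicit
open NE3EnergyShapes (IsUnitarySite IsPeriodicSite)
open MinimalActionCompact (isCompact_unitaryUnits)
open NE7DefectIterationCompact (exists_zero_defect_local_of_compact)

noncomputable section

variable {d : ℕ} {n : Type*} [Fintype n] [DecidableEq n]

/-! ## §1 Compactness of the unitary periodic site gauges -/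

/-- evaluation at a site is continuous (product topology). [folklore] -/
theorem continuous_site_eval (x : Site d) : Continuous fun u : Site d → (Matrix n n ℂ)ˣ => u x := continuous_apply x

/-- periodicity of a site gauge is a closed condition. [folklore] -/
theorem isClosed_isPeriodicSite (P : ℤ) : IsClosed {u : Site d → (Matrix n n ℂ)ˣ | IsPeriodicSite u P} := by
  simp only [IsPeriodicSite, Set.setOf_forall]
  exact isClosed_iInter fun x => isClosed_iInter fun i => isClosed_eq (continuous_site_eval _) (continuous_site_eval x)

/-- the unitary site gauges form a compact set (Tychonoff over the sites; `U(n)` is compact in the units topology). [folklore] -/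
theorem isCompact_unitarySite : IsCompact {u : Site d → (Matrix n n ℂ)ˣ | IsUnitarySite u} := by
  have h : {u : Site d → (Matrix n n ℂ)ˣ | IsUnitarySite u}
      = {u | ∀ x, u x ∈ {g : (Matrix n n ℂ)ˣ | (g : Matrix n n ℂ) ∈ unitary (Matrix n n ℂ)}} := by
    ext u
    simp only [Set.mem_setOf_eq, IsUnitarySite, mem_unitaryUnits]
  rw [h]
  exact isCompact_pi_infinite fun _ => isCompact_unitaryUnits

/-- **THE UNITARY `P`-PERIODIC SITE GAUGES FORM A COMPACT SET.** [folklore] -/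
theorem isCompact_unitaryPeriodicSite (P : ℤ) : IsCompact {u : Site d → (Matrix n n ℂ)ˣ | IsUnitarySite u ∧ IsPeriodicSite u P} := by
  have h : {u : Site d → (Matrix n n ℂ)ˣ | IsUnitarySite u ∧ IsPeriodicSite u P}
      = {u | IsUnitarySite u} ∩ {u | IsPeriodicSite u P} := by ext u; simp only [Set.mem_setOf_eq, Set.mem_inter_iff]
  rw [h]
  exact isCompact_unitarySite.inter_right (isClosed_isPeriodicSite P)

/-! ## §2 The engine on the gauge group -/

/-- **THE (S1) EXISTENCE ENGINE ON THE PERIODIC UNITARY GAUGE GROUP**: let `K = {u | IsUnitarySite u ∧ IsPeriodicSite u P}`; `Φ : (Site d → (Matrix n n ℂ)ˣ) → E` continuous on `K`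
(the size: e.g. the relative links of the pair on the period box, sup norm), `Df` continuous and nonnegative on the working region `{u ∈ K | ‖Φ u‖ ≤ S}` (the defect); a step `step` that keeps
unitarity and periodicity, contracts `Df` by `θ ∈ [0,1)` and moves `‖Φ‖` by `≤ A·Df` on the working region; `s₀ + A·δ₀∕(1−θ) ≤ S`; a datum `u₀ ∈ K` with `‖Φ u₀‖ ≤ s₀`, `Df u₀ ≤ δ₀`.
THEN there is a unitary `P`-periodic site gauge `u` with `Df u = 0` and `‖Φ u‖ ≤ s₀ + A·δ₀∕(1 − θ)`. [folklore] -/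
theorem exists_zero_defect_gauge {E : Type*} [SeminormedAddCommGroup E] {P : ℤ}
    {step : (Site d → (Matrix n n ℂ)ˣ) → (Site d → (Matrix n n ℂ)ˣ)} {Φ : (Site d → (Matrix n n ℂ)ˣ) → E} {Df : (Site d → (Matrix n n ℂ)ˣ) → ℝ}
    {θ A S s₀ δ₀ : ℝ} {u₀ : Site d → (Matrix n n ℂ)ˣ}
    (hΦ : ContinuousOn Φ {u | IsUnitarySite u ∧ IsPeriodicSite u P})
    (hDf : ContinuousOn Df {u | u ∈ {u : Site d → (Matrix n n ℂ)ˣ | IsUnitarySite u ∧ IsPeriodicSite u P} ∧ ‖Φ u‖ ≤ S})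
    (hDf0 : ∀ u ∈ {u : Site d → (Matrix n n ℂ)ˣ | IsUnitarySite u ∧ IsPeriodicSite u P}, ‖Φ u‖ ≤ S → 0 ≤ Df u)
    (hθ0 : 0 ≤ θ) (hθ1 : θ < 1) (hA : 0 ≤ A) (hδ₀ : 0 ≤ δ₀) (hS : s₀ + A * δ₀ / (1 - θ) ≤ S)
    (hmaps : ∀ u : Site d → (Matrix n n ℂ)ˣ, IsUnitarySite u → IsPeriodicSite u P → ‖Φ u‖ ≤ S → IsUnitarySite (step u) ∧ IsPeriodicSite (step u) P)
    (hcontr : ∀ u : Site d → (Matrix n n ℂ)ˣ, IsUnitarySite u → IsPeriodicSite u P → ‖Φ u‖ ≤ S → Df (step u) ≤ θ * Df u)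
    (hgrow : ∀ u : Site d → (Matrix n n ℂ)ˣ, IsUnitarySite u → IsPeriodicSite u P → ‖Φ u‖ ≤ S → ‖Φ (step u)‖ ≤ ‖Φ u‖ + A * Df u)
    (hu₀ : IsUnitarySite u₀) (hu₀P : IsPeriodicSite u₀ P) (hs₀ : ‖Φ u₀‖ ≤ s₀) (hd₀ : Df u₀ ≤ δ₀) :
    ∃ u : Site d → (Matrix n n ℂ)ˣ, IsUnitarySite u ∧ IsPeriodicSite u P ∧ Df u = 0 ∧ ‖Φ u‖ ≤ s₀ + A * δ₀ / (1 - θ) := by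
  -- the ambient product is first countable: countably many factors, each embedded in the metrisable `M × Mᵐᵒᵖ`
  haveI : FirstCountableTopology ((Matrix n n ℂ)ˣ) := (Units.isInducing_embedProduct (M := Matrix n n ℂ)).firstCountableTopology
  obtain ⟨u, hu, hD, hN⟩ := exists_zero_defect_local_of_compact (K := {u | IsUnitarySite u ∧ IsPeriodicSite u P})
    (isCompact_unitaryPeriodicSite P) hΦ hDf hDf0 hθ0 hθ1 hA hδ₀ hS
    (fun u hu hS' => hmaps u hu.1 hu.2 hS') (fun u hu hS' => hcontr u hu.1 hu.2 hS') (fun u hu hS' => hgrow u hu.1 hu.2 hS')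
    ⟨hu₀, hu₀P⟩ hs₀ hd₀
  exact ⟨u, hu.1, hu.2, hD, hN⟩

end

end Summit.QuantumFields.BalabanUV.T4Continuum.NE7GaugeGroupCompact
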